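import Mathlib
import Summits.Ventures.PercRepro2.Defs
import Summits.Ventures.PercRepro2.Independence
import Summits.Ventures.PercRepro2.Harris
import Summits.Ventures.PercRepro2.Graph
import Summits.Ventures.PercRepro2.Events
import Summits.Ventures.PercRepro2.ZCDismantle

/-!
# The dismantling theorem at work: the two-cycle graph in ten lines
(blind cell PercRepro2, mine-a g24; MINE-A.md §72.10)

`zc_two_cycles` (Theorem E twice, then the tree theorem, `ZCTwoCycles`) re-derived from
`zc_of_dismantling_all`: the graph `0 — 1 — 2 — 0`, `0 — 2 — 4 — 3 — 0` with the marks `(0, 1, 3)` is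
dismantled by the records E at `1` (edges `{0,1}`, `{1,2}`; the `a₃`-mark moves to `2`), E at `2`
(edges `{0,2}`, `{2,4}`; the mark moves to `4`), leaf `4` at `3` (edge `{3,4}`; the mark moves to `3`)
and leaf `3` at `0` (edge `{0,3}`).  All side conditions are decided by `decide` / `fin_cases`.
Likewise the four-cycle of `zc_cycle_four` (E at `1`, leaf `2` at `3`, leaf `3` at `0`) and the theta
graph `0 — 1`, `0 — 2 — 1`, `0 — 3 — 1` with the marks `(0, 2, 3)` (E at `2` with `w = 1`, E at `1` with
`w = o = 3`, leaf `3` at `0`) — the second neighbour `w` of an E-record may be the mark `o`.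
-/

namespace Summit.Ventures.PercRepro2

/-- **(ZC) on the two-cycle graph** of `zc_two_cycles`, by the dismantling theorem. -/
theorem zc_two_cycles' {R : Type*} [CommRing R] [LinearOrder R] [IsStrictOrderedRing R]
    {p : Fin 6 → R} (hp : IsProbVec p) {𝓔 : Set (Set (Fin 5))} (h𝓔 : IsUpperSet 𝓔) :
    let ends : Fin 6 → Sym2 (Fin 5) := ![s(0, 1), s(1, 2), s(0, 2), s(2, 4), s(0, 3), s(3, 4)]
    let e := connEvent ends 0 1
    let L' := connEvent ends 0 3
    let U := clusterInEvent ends 0 𝓔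
    let γ := connEvent ends 1 3
    0 ≤ prob p (eᶜ ∩ L'ᶜ ∩ γᶜ) * (prob p (U ∩ (e ∩ L')) - prob p U * prob p (e ∩ L'))
      - prob p (eᶜ ∩ L'ᶜ ∩ γ) * (prob p (U ∩ (e ∩ L'ᶜ)) - prob p U * prob p (e ∩ L'ᶜ)) := by
  intro ends e L' U γ
  have h := zc_of_dismantling_all (ends := ends)
    [((0 : Fin 5), (0 : Fin 6), (1 : Fin 6), (1 : Fin 5), (2 : Fin 5), (0 : Fin 5), (1 : Fin 5), (3 : Fin 5)),
     (0, 2, 3, 2, 4, 0, 2, 3), (4, 5, 5, 4, 3, 0, 4, 3), (4, 4, 4, 3, 0, 0, 3, 3)]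
    (by decide) (by decide) (by decide) p hp
    (by intro r hr e he; fin_cases hr <;> fin_cases e <;> simp_all [ends, Sym2.mem_iff])
    (by intro e _; fin_cases e <;> decide)
    (0, 1, 3) (by intro r hr; simp at hr; rw [← hr]) h𝓔
  simpa using h

/-- **(ZC) on the four-cycle** `0 — 1 — 2 — 3 — 0` with the marks `(0, 1, 3)` (`zc_cycle_four`), by the
dismantling theorem: E at `1`, leaf `2` at `3`, leaf `3` at `0`. -/
theorem zc_cycle_four' {R : Type*} [CommRing R] [LinearOrder R] [IsStrictOrderedRing R]
    {p : Fin 4 → R} (hp : IsProbVec p) {𝓔 : Set (Set (Fin 4))} (h𝓔 : IsUpperSet 𝓔) :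
    let ends : Fin 4 → Sym2 (Fin 4) := ![s(0, 1), s(1, 2), s(2, 3), s(3, 0)]
    let e := connEvent ends 0 1
    let L' := connEvent ends 0 3
    let U := clusterInEvent ends 0 𝓔
    let γ := connEvent ends 1 3
    0 ≤ prob p (eᶜ ∩ L'ᶜ ∩ γᶜ) * (prob p (U ∩ (e ∩ L')) - prob p U * prob p (e ∩ L'))
      - prob p (eᶜ ∩ L'ᶜ ∩ γ) * (prob p (U ∩ (e ∩ L'ᶜ)) - prob p U * prob p (e ∩ L'ᶜ)) := by
  intro ends e L' U γ
  have h := zc_of_dismantling_all (ends := ends)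
    [((0 : Fin 5), (0 : Fin 4), (1 : Fin 4), (1 : Fin 4), (2 : Fin 4), (0 : Fin 4), (1 : Fin 4), (3 : Fin 4)),
     (4, 2, 2, 2, 3, 0, 2, 3), (4, 3, 3, 3, 0, 0, 3, 3)]
    (by decide) (by decide) (by decide) p hp
    (by intro r hr e he; fin_cases hr <;> fin_cases e <;> simp_all [ends, Sym2.mem_iff])
    (by intro e _; fin_cases e <;> decide)
    (0, 1, 3) (by intro r hr; simp at hr; rw [← hr]) h𝓔
  simpa using h

/-- **(ZC) on the theta graph** `0 — 1`, `0 — 2 — 1`, `0 — 3 — 1` (edges `0 = {0,1}`, `1 = {0,2}`,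
`2 = {2,1}`, `3 = {0,3}`, `4 = {3,1}`) with the marks `(0, 2, 3)`: E at `2` (`w = 1`), E at `1`
(`w = 3 = o`), leaf `3` at `0`. -/
theorem zc_theta {R : Type*} [CommRing R] [LinearOrder R] [IsStrictOrderedRing R]
    {p : Fin 5 → R} (hp : IsProbVec p) {𝓔 : Set (Set (Fin 4))} (h𝓔 : IsUpperSet 𝓔) :
    let ends : Fin 5 → Sym2 (Fin 4) := ![s(0, 1), s(0, 2), s(2, 1), s(0, 3), s(3, 1)]
    let e := connEvent ends 0 2
    let L' := connEvent ends 0 3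
    let U := clusterInEvent ends 0 𝓔
    let γ := connEvent ends 2 3
    0 ≤ prob p (eᶜ ∩ L'ᶜ ∩ γᶜ) * (prob p (U ∩ (e ∩ L')) - prob p U * prob p (e ∩ L'))
      - prob p (eᶜ ∩ L'ᶜ ∩ γ) * (prob p (U ∩ (e ∩ L'ᶜ)) - prob p U * prob p (e ∩ L'ᶜ)) := by
  intro ends e L' U γ
  have h := zc_of_dismantling_all (ends := ends)
    [((0 : Fin 5), (1 : Fin 5), (2 : Fin 5), (2 : Fin 4), (1 : Fin 4), (0 : Fin 4), (2 : Fin 4), (3 : Fin 4)),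
     (0, 0, 4, 1, 3, 0, 1, 3), (4, 3, 3, 3, 0, 0, 3, 3)]
    (by decide) (by decide) (by decide) p hp
    (by intro r hr e he; fin_cases hr <;> fin_cases e <;> simp_all [ends, Sym2.mem_iff])
    (by intro e _; fin_cases e <;> decide)
    (0, 2, 3) (by intro r hr; simp at hr; rw [← hr]) h𝓔
  simpa using h

end Summit.Ventures.PercRepro2
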